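import Summits.BirchSwinnertonDyer.BirchSwinnertonDyer.Theorems.Rank1ResidualJetCarrierNeIndexKernel
import Summits.BirchSwinnertonDyer.BirchSwinnertonDyer.Theorems.Rank1ResidualJetCarrierMult
import Summits.BirchSwinnertonDyer.BirchSwinnertonDyer.Theorems.Rank1ResidualJetCarrierAdd
import HarnessLib

/-!
# T1 JET (cell `bsd-jet`), carrier `p` (buckets B-mult K3 and B-add K4): the JET class-free consumers
# IN THE KERNEL on the INDEX-FINITENESS line — `BSD(E,p)` ⟸ {Poitou–Tate for Selmer structures, F1,
# Gross 3.7 (2), GZK} and the row's certificate; NO reading binder, NO McCallum 5.2 / Cor. 5.6, NO Kolyvagin theorem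

HONEST FRAMING (programme file `BSD-LIT2PART-PROGRAMME-v1.md` §HONESTY, verbatim): «no tranche here
proves BSD; ARM L moves the LITERAL column of an r ≤ 1 census into the kernel-proved-modulo-named-print
column; ARM P changes what «named print» is worth.» THEOREMS ONLY (seat `bsd-jet-pv-2`, session g7;
`--supports stmt-BirchSwinnertonDyer-14418`, helper); nothing is booked, 0 classes move (road K is
DOCUMENTARY; bookings are referee A's). Nothing about any particular curve is asserted.

WHAT. Sibling of `Rank1ResidualJetCarrierNeIndexKernel` (bucket A, carrier `q ≠ p`) for the carrier
`p` itself: the consumers `JET.bsdp_of_carrierMultCertificate[_of_surj]` (K3, `p` multiplicative;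
`Rank1ResidualJetCarrierMult`) and `JET.bsdp_of_carrierAddCertificate` (K4, `p` additive;
`Rank1ResidualJetCarrierAdd`) with McCallum Cor. 5.6 (`hMcU`) AND Kolyvagin's theorem (`hKo`) REMOVED on
the line where the register's index datum is read as a FINITE index `[E(K):ℤP] ≠ 0`. The argument is
CARRIER-FREE and is isolated once:
* §1 `sha_primary_eq_bot_of_globalDepth_of_index_ne_zero` — for ANY depth `t` with `ord_p [E(K):ℤP] ≤ t`
  and global divisibility of the derived Heegner points to every depth `s ≤ t` on every frame of `P`
  (the common conclusion shape of K1/K3/K4), `Ш(E/K)[p^∞] = ⊥`: `M₀ := ord_p [E(K):ℤP]`, `p^{M₀+1} ∤ P`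
  by group theory (`not_exists_pow_succ_smul_eq_of_index_ne_zero`), pv-1's divided descent
  `JET.DividedDescent.sha_primary_eq_bot_of_globalDivisibility` with its Poitou–Tate input the tree
  theorem `poitouTate_sum_localTatePairing_eq_zero_of_isTotallyComplex`; then `Ш(E/ℚ)[p] = 0` and
  `BSD(E,p)` (`noPTorsion_…`, `bsdp_of_globalDepth_of_index_ne_zero`).
* §2 K3: `bsdp_of_carrierMultCertificate_of_index_ne_zero` (binders `hJ`, `h44`, `hF1`, `hrec`, `hD36`,
  `hGZK`) and `…_of_swapLiterature_of_index_ne_zero_of_surj` — every class-free binder except GZK FED BY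
  NAME (`jetchevDivisibilityCarrierMult_of_swapLiterature`, `prop44_of_frobeniusCongruence`, the Literature
  theorems for `hrec`/`hD36`; tower from `ρ̄_{E,p}` onto at a multiplicative odd `p`), + level form.
* §3 K4: the same for `bsdp_of_carrierAddCertificate` (+ level form; the tower stays a binder — at
  `p = 3` it is the mod-9 Frobenius certificate of the rows, at `p ≥ 5` Serre).
DISPLAYED named print of the fed forms: `poitouTate_selmerStructure_duality_conj` (∀ K),
`Gross1991_heegnerPoint_sub_ratTorsion_mem_E0`, `GrossLMS1991.prop37_2_frobeniusCongruence`,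
`rank_eq_analyticRank_of_analyticRank_le_one` (+ `exists_isNewformOf` in the level forms) — nothing else.
References: [cite: Jetchev2008, Thm. 1.4, Cor. 1.5 (p. 812)] [cite: McCallumLMS1991, §5 Lemma 5.1,
Cor. 5.6] [cite: GrossLMS1991, §10] [cite: Wuthrich2014, Lemma 20 (p. 399)] [cite: CasselsFrohlichANT1967,
Ch. VII §11]. Design: no definitions; `K : Type`. Axioms: `propext`, `Classical.choice`, `Quot.sound`.
-/

set_option autoImplicit false

noncomputable section

open scoped Classical

open WeierstrassCurve Literature.NumberTheory.EllipticCurves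
  Literature.NumberTheory.EllipticCurves.ModularForms
  Literature.NumberTheory.EllipticCurves.Rank1Residual
  Literature.NumberTheory.GaloisCohomology
  Summit.BirchSwinnertonDyer.Rank1Residual Summit.BirchSwinnertonDyer.Rank1Residual.X11b

namespace Summit.BirchSwinnertonDyer.Rank1Residual.JET

/-! ### §1 The carrier-free core: global divisibility to depth `t ≥ ord_p [E(K):ℤP]` ⟹ `Ш(E/K)[p^∞] = ⊥` -/

/-- **No CM from the tower at an odd prime** (`ρ̄_{E,p}` onto; Zywina 2015 Prop. 1.14 / Serre 1972 §4.5,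
tree theorem `not_hasSurjectiveModNGaloisRep_of_hasCM`). [cite: Serre1972, §4.5] -/
theorem not_hasCM_of_tower (W : WeierstrassCurve ℚ) [W.IsElliptic] (p : ℕ) [Fact p.Prime] (hp2 : p ≠ 2)
    (htower : ∀ n : ℕ, W.HasSurjectiveModNGaloisRep (p ^ n : ℕ)) : ¬ W.HasCM := fun hCM ↦ by
  have hsurj : W.HasSurjectiveModNGaloisRep (p : ℤ) := by simpa using htower 1
  exact W.not_hasSurjectiveModNGaloisRep_of_hasCM hCM (Fact.out : p.Prime) hp2 (by simpa using hsurj)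

/-- **`Ш(E/K)[p^∞] = ⊥` from global divisibility to a depth `t ≥ ord_p [E(K):ℤP]`, finite index —
carrier-free core.** `W/ℚ` globally minimal, `p` odd with the `p`-adic tower onto, `K` imaginary
quadratic Heegner for `N_E` with `d_K ∉ {−3,−4}`, `P ∈ E(K)` a Heegner point of infinite order with
`[E(K):ℤP] ≠ 0` and `ord_p [E(K):ℤP] ≤ t`; `hGD`: on every frame `(Dt, β, ι, d₁)` whose `P_1` has
infinite order, every derived point `P_n` (square-free `n` over Zhang–Kolyvagin primes of index `≥ s`)
is `p^s`-divisible for every `s ≤ t` — the conclusion of K1 ∕ K3 ∕ K4 with their carrier clause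
discharged. Class-free inputs: [McC] 4.4 `h44`, F1 `hF1` (named print), `hrec`, `hD36` (Literature
theorems). Proof: frame; `M₀ := ord_p [E(K):ℤP]`; `p^{M₀+1} ∤ P` (group theory); `hGD` at `s = M₀`;
divided descent with the tree's Poitou–Tate sum theorem at `K`. [cite: Jetchev2008, Cor. 1.5 (p. 812)]
[cite: McCallumLMS1991, §5 Lemma 5.1, Cor. 5.6] [cite: GrossLMS1991, §10] [cite: CasselsFrohlichANT1967, Ch. VII §11] -/
theorem sha_primary_eq_bot_of_globalDepth_of_index_ne_zero
    (h44 : McCallum1991.prop44_localOrder_kolyvaginClass_mul_eq)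
    (hF1 : Gross1991_heegnerPoint_sub_ratTorsion_mem_E0)
    (W : WeierstrassCurve ℚ) [W.IsElliptic] [W.IsGloballyMinimal] [NeZero (W.conductorNorm ℤ)]
    (K : Type) [Field K] [NumberField K]
    (hrec : heegnerPointOfConductor_one_galoisConj (W.conductorNorm ℤ) W K)
    (hD36 : phi_heegnerTau_mem_singularModuliField (W.conductorNorm ℤ) W K)
    (hK : IsImaginaryQuadratic K)
    (hD3 : NumberField.discr K ≠ -3) (hD4 : NumberField.discr K ≠ -4)
    (hH : SatisfiesHeegnerHypothesis (W.conductorNorm ℤ) K)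
    (p : ℕ) [Fact p.Prime] (hp2 : p ≠ 2)
    (htower : ∀ n : ℕ, W.HasSurjectiveModNGaloisRep (p ^ n : ℕ))
    {P : (W.baseChange K).toAffine.Point} (hP : IsHeegnerPoint (W.conductorNorm ℤ) W K P)
    (hnt : ¬ IsOfFinAddOrder P) (t : ℕ)
    (hGD : ∀ (Dt : ModularParametrizationData W (W.conductorNorm ℤ)) (β : ℤ) (ι : K →+* ℂ)
      (d₁ : KolyvaginHeegnerData Dt β ι 1), ¬ IsOfFinAddOrder d₁.derivedPoint →
      ∀ (s : ℕ), s ≤ t → ∀ (n : ℕ) (d : KolyvaginHeegnerData Dt β ι n), Squarefree n →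
        (∀ ℓ ∈ n.primeFactors, Zhang2014.IsKolyvaginPrime (W.conductorNorm ℤ) W K p ℓ ∧
          s ≤ Zhang2014.kolyvaginIndex W p ℓ) →
        ∃ Q : (W.baseChange (ringClassField K ι n)).toAffine.Point,
          ((p ^ s : ℕ) : ℤ) • Q = d.derivedPoint)
    (hfin : (AddSubgroup.zmultiples P).index ≠ 0)
    (hI : padicValNat p (AddSubgroup.zmultiples P).index ≤ t) :
    AddCommGroup.primaryComponent (W.baseChange K).sha p = ⊥ := by
  have hcm : ¬ W.HasCM := not_hasCM_of_tower W p hp2 htower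
  -- a frame of `P` and a conductor-1 datum on it (Darmon 3.6), with bottom point `P` (Shimura)
  obtain ⟨Dt, H, ι, hPc⟩ := id hP
  obtain ⟨d₁⟩ := exists_kolyvaginHeegnerData_one hD36 hK Dt H.β ι H.dvd_sq_sub
  have hPd : d₁.toGeomPoints d₁.derivedPoint = toGeomPoints (W.baseChange K) P :=
    KolyvaginBottom.toGeomPoints_derivedPoint_one_eq hrec hK hH hPc d₁ rfl
  have hy₁ : ¬ IsOfFinAddOrder d₁.derivedPoint := by
    intro hfo
    apply hnt
    have h1 : IsOfFinAddOrder (d₁.toGeomPoints d₁.derivedPoint) := d₁.toGeomPoints.isOfFinAddOrder hfo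
    rw [hPd] at h1
    exact (toGeomPoints_injective (W.baseChange K)).isOfFinAddOrder_iff.mp h1
  -- the depth `M₀ = ord_p [E(K):ℤP]`
  set M₀ := padicValNat p (AddSubgroup.zmultiples P).index with hM₀
  have hmax : ¬ ∃ Q : (W.baseChange K).toAffine.Point, ((p ^ (M₀ + 1) : ℕ) : ℤ) • Q = P :=
    not_exists_pow_succ_smul_eq_of_index_ne_zero p hnt hfin
  -- Poitou–Tate sum formula at `K` (tree theorem) and the divided descent
  haveI : NumberField.IsTotallyComplex K := hK.isTotallyComplex
  exact DividedDescent.sha_primary_eq_bot_of_globalDivisibility W hcm K hK hD3 hD4 hH p hp2 htower Dt H.β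
    ι d₁ P hPd hP hnt M₀ hmax (fun n d hn hℓ ↦ hGD Dt H.β ι d₁ hy₁ M₀ hI n d hn hℓ)
    (poitouTate_sum_localTatePairing_eq_zero_of_isTotallyComplex K) h44 hF1

/-- **`Ш(E/ℚ)[p] = 0` from the carrier-free core** (restriction injective on `p`-torsion, `p` odd,
`[K:ℚ] = 2`). [cite: Jetchev2008, Cor. 1.5 (p. 812)] [cite: SerreGaloisCohomology1997, I.§2.4 Cor. to Prop. 9] -/
theorem noPTorsion_of_globalDepth_of_index_ne_zero
    (h44 : McCallum1991.prop44_localOrder_kolyvaginClass_mul_eq)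
    (hF1 : Gross1991_heegnerPoint_sub_ratTorsion_mem_E0)
    (W : WeierstrassCurve ℚ) [W.IsElliptic] [W.IsGloballyMinimal] [NeZero (W.conductorNorm ℤ)]
    (K : Type) [Field K] [NumberField K]
    (hrec : heegnerPointOfConductor_one_galoisConj (W.conductorNorm ℤ) W K)
    (hD36 : phi_heegnerTau_mem_singularModuliField (W.conductorNorm ℤ) W K)
    (hK : IsImaginaryQuadratic K)
    (hD3 : NumberField.discr K ≠ -3) (hD4 : NumberField.discr K ≠ -4)
    (hH : SatisfiesHeegnerHypothesis (W.conductorNorm ℤ) K)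
    (p : ℕ) [Fact p.Prime] (hp2 : p ≠ 2)
    (htower : ∀ n : ℕ, W.HasSurjectiveModNGaloisRep (p ^ n : ℕ))
    {P : (W.baseChange K).toAffine.Point} (hP : IsHeegnerPoint (W.conductorNorm ℤ) W K P)
    (hnt : ¬ IsOfFinAddOrder P) (t : ℕ)
    (hGD : ∀ (Dt : ModularParametrizationData W (W.conductorNorm ℤ)) (β : ℤ) (ι : K →+* ℂ)
      (d₁ : KolyvaginHeegnerData Dt β ι 1), ¬ IsOfFinAddOrder d₁.derivedPoint →
      ∀ (s : ℕ), s ≤ t → ∀ (n : ℕ) (d : KolyvaginHeegnerData Dt β ι n), Squarefree n →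
        (∀ ℓ ∈ n.primeFactors, Zhang2014.IsKolyvaginPrime (W.conductorNorm ℤ) W K p ℓ ∧
          s ≤ Zhang2014.kolyvaginIndex W p ℓ) →
        ∃ Q : (W.baseChange (ringClassField K ι n)).toAffine.Point,
          ((p ^ s : ℕ) : ℤ) • Q = d.derivedPoint)
    (hfin : (AddSubgroup.zmultiples P).index ≠ 0)
    (hI : padicValNat p (AddSubgroup.zmultiples P).index ≤ t) :
    ∀ x : W.sha, (p : ℤ) • x = 0 → x = 0 := by
  have hpp : p.Prime := Fact.out
  have hbot := sha_primary_eq_bot_of_globalDepth_of_index_ne_zero h44 hF1 W K hrec hD36 hK hD3 hD4 hH p hp2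
    htower hP hnt t hGD hfin hI
  haveI : IsGalois ℚ K := by
    haveI : Algebra.IsQuadraticExtension ℚ K := ⟨hK.1⟩
    infer_instance
  have hcop : p.Coprime (Module.finrank ℚ K) := by
    rw [hK.1]
    exact (Nat.coprime_primes hpp Nat.prime_two).mpr hp2
  intro x hx
  have hxn : p • x = 0 := by rw [← natCast_zsmul]; exact hx
  have hres : shaRestriction W K x = 0 := by
    have hpr : p ^ 1 • shaRestriction W K x = 0 := by rw [pow_one, ← map_nsmul, hxn, map_zero]
    have hmem : shaRestriction W K x ∈ AddCommGroup.primaryComponent (W.baseChange K).sha p :=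
      (AddCommGroup.mem_primaryComponent).mpr ⟨1, hpr⟩
    rw [hbot] at hmem
    exact (AddSubgroup.mem_bot).mp hmem
  have hx_mem : x ∈ (AddSubgroup.torsionBy W.sha p : Set W.sha) :=
    AddSubgroup.torsionBy.nsmul_iff.mpr hxn
  have h0_mem : (0 : W.sha) ∈ (AddSubgroup.torsionBy W.sha p : Set W.sha) :=
    AddSubgroup.torsionBy.nsmul_iff.mpr (smul_zero _)
  exact injOn_shaRestriction_torsionBy W K hcop hx_mem h0_mem (by rw [hres, map_zero])

/-! ### §2 Carrier `p` MULTIPLICATIVE (K3) -/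

/-- **`BSD(E,p)` from the bucket-B (multiplicative) certificate on the index-finiteness line.** `p` odd
multiplicative with the `p`-adic tower, `ord_p [E(K):ℤP] ≤ ord_p c_p`, `[E(K):ℤP] ≠ 0`, analytic rank
`≤ 1`, `#Ш_an` a `p`-unit. Class-free binders: `hJ` (K3), `h44`, `hF1`, `hrec`, `hD36`, `hGZK` — NO `hKo`,
NO `hMcU`. [cite: Jetchev2008, Thm. 1.4, Cor. 1.5 (p. 812)] [cite: Miller2011LMS, Def. 1.1] -/
theorem bsdp_of_carrierMultCertificate_of_index_ne_zero
    (hJ : JetchevDivisibilityCarrierMult)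
    (h44 : McCallum1991.prop44_localOrder_kolyvaginClass_mul_eq)
    (hF1 : Gross1991_heegnerPoint_sub_ratTorsion_mem_E0)
    (hGZK : rank_eq_analyticRank_of_analyticRank_le_one)
    (W : WeierstrassCurve ℚ) [W.IsElliptic] [W.IsGloballyMinimal] [NeZero (W.conductorNorm ℤ)]
    (K : Type) [Field K] [NumberField K]
    (hrec : heegnerPointOfConductor_one_galoisConj (W.conductorNorm ℤ) W K)
    (hD36 : phi_heegnerTau_mem_singularModuliField (W.conductorNorm ℤ) W K)
    (hK : IsImaginaryQuadratic K) (hD3 : NumberField.discr K ≠ -3) (hD4 : NumberField.discr K ≠ -4)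
    (hH : SatisfiesHeegnerHypothesis (W.conductorNorm ℤ) K)
    (p : ℕ) [Fact p.Prime] (hp2 : p ≠ 2) (hmult : W.HasMultiplicativeReductionAtPrime p)
    (htower : ∀ n : ℕ, W.HasSurjectiveModNGaloisRep (p ^ n : ℕ))
    {P : (W.baseChange K).toAffine.Point} (hP : IsHeegnerPoint (W.conductorNorm ℤ) W K P)
    (hnt : ¬ IsOfFinAddOrder P) (hfin : (AddSubgroup.zmultiples P).index ≠ 0)
    (hI : padicValNat p (AddSubgroup.zmultiples P).index ≤
      padicValNat p ((W.baseChange ℚ_[p]).localTamagawaNumber ℤ_[p]))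
    (hr : W.analyticRank ≤ 1) {s : ℚ} (hs : shaAn W = (s : ℂ)) (hv : padicValRat p s = 0) :
    BSDp W p :=
  Typed.bsdp_of_shaAn_unit_of_noPTorsion W p hGZK hr hs hv
    (noPTorsion_of_globalDepth_of_index_ne_zero h44 hF1 W K hrec hD36 hK hD3 hD4 hH p hp2 htower hP hnt _
      (fun Dt β ι d₁ hy₁ s hs' n d hn hℓ ↦
        hJ W (not_hasCM_of_tower W p hp2 htower) K hK hD3 hD4 hH p hp2 hmult htower Dt β ι d₁ hy₁ s hs' n
          d hn hℓ) hfin hI)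

/-- **The bucket-B (multiplicative) JET door on the index-finiteness line from NAMED PRINT ONLY, with
the register's galrep datum `ρ̄_{E,p}` onto**: K3 := `jetchevDivisibilityCarrierMult_of_swapLiterature`
(road K, McCallum 5.2 struck), [McC] 4.4 := `prop44_of_frobeniusCongruence`, `hrec`/`hD36` := the
Literature theorems, the tower from mod-`p` surjectivity at a multiplicative odd `p` (Tate line, tree
theorem `forall_hasSurjectiveModNGaloisRep_pow_of_multiplicative_of_surj`). DISPLAYED named print:
{`hPT` (∀ K), `hF1`, `h372`, `hGZK`}. [cite: Jetchev2008, Thm. 1.4, Cor. 1.5 (p. 812)]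
[cite: Wuthrich2014, Lemma 20 (p. 399)] [cite: GrossLMS1991, Prop. 3.7 (2), §10] -/
theorem bsdp_of_carrierMultCertificate_of_swapLiterature_of_index_ne_zero_of_surj
    (hPT : ∀ (K : Type) [Field K] [NumberField K], poitouTate_selmerStructure_duality_conj K)
    (hF1 : Gross1991_heegnerPoint_sub_ratTorsion_mem_E0)
    (h372 : GrossLMS1991.prop37_2_frobeniusCongruence)
    (hGZK : rank_eq_analyticRank_of_analyticRank_le_one)
    (W : WeierstrassCurve ℚ) [W.IsElliptic] [W.IsGloballyMinimal] [NeZero (W.conductorNorm ℤ)]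
    (K : Type) [Field K] [NumberField K] (hK : IsImaginaryQuadratic K)
    (hD3 : NumberField.discr K ≠ -3) (hD4 : NumberField.discr K ≠ -4)
    (hH : SatisfiesHeegnerHypothesis (W.conductorNorm ℤ) K)
    (p : ℕ) [Fact p.Prime] (hp2 : p ≠ 2) (hmult : W.HasMultiplicativeReductionAtPrime p)
    (hsurj : W.HasSurjectiveModNGaloisRep p)
    {P : (W.baseChange K).toAffine.Point} (hP : IsHeegnerPoint (W.conductorNorm ℤ) W K P)
    (hnt : ¬ IsOfFinAddOrder P) (hfin : (AddSubgroup.zmultiples P).index ≠ 0)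
    (hI : padicValNat p (AddSubgroup.zmultiples P).index ≤
      padicValNat p ((W.baseChange ℚ_[p]).localTamagawaNumber ℤ_[p]))
    (hr : W.analyticRank ≤ 1) {s : ℚ} (hs : shaAn W = (s : ℂ)) (hv : padicValRat p s = 0) :
    BSDp W p :=
  bsdp_of_carrierMultCertificate_of_index_ne_zero (jetchevDivisibilityCarrierMult_of_swapLiterature hPT hF1 h372)
    (prop44_of_frobeniusCongruence h372) hF1 hGZK W K
    (heegnerPointOfConductor_one_galoisConj_holds (W.conductorNorm ℤ) W K)
    (phi_heegnerTau_mem_singularModuliField_holds (W.conductorNorm ℤ) W K) hK hD3 hD4 hH p hp2 hmult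
    (fun n ↦ W.forall_hasSurjectiveModNGaloisRep_pow_of_multiplicative_of_surj p hp2 hmult hsurj n) hP hnt
    hfin hI hr hs hv

/-- **Level form** (the register rows' shape: Heegner datum at a stated level `N`, `N = N_E` by
Carayol from modularity `hmod`). Displayed named print: {PT, F1, Gross 3.7 (2), GZK, modularity}.
[cite: Jetchev2008, Cor. 1.5 (p. 812)] [cite: DiamondShurman2005, Thm. 8.8.1] -/
theorem bsdp_of_carrierMultCertificate_level_of_swapLiterature_of_index_ne_zero_of_surj
    (hPT : ∀ (K : Type) [Field K] [NumberField K], poitouTate_selmerStructure_duality_conj K)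
    (hF1 : Gross1991_heegnerPoint_sub_ratTorsion_mem_E0)
    (h372 : GrossLMS1991.prop37_2_frobeniusCongruence)
    (hGZK : rank_eq_analyticRank_of_analyticRank_le_one) (hmod : exists_isNewformOf)
    (W : WeierstrassCurve ℚ) [W.IsElliptic] [W.IsGloballyMinimal] (p : ℕ) [Fact p.Prime]
    {N : ℕ} [NeZero N] {K : Type} [Field K] [NumberField K] (hK : IsImaginaryQuadratic K)
    (hD3 : NumberField.discr K ≠ -3) (hD4 : NumberField.discr K ≠ -4)
    (hH : SatisfiesHeegnerHypothesis N K) {P : (W.baseChange K).toAffine.Point}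
    (hP : IsHeegnerPoint N W K P) (hnt : ¬ IsOfFinAddOrder P)
    (hp2 : p ≠ 2) (hmult : W.HasMultiplicativeReductionAtPrime p) (hsurj : W.HasSurjectiveModNGaloisRep p)
    (hfin : (AddSubgroup.zmultiples P).index ≠ 0)
    (hI : padicValNat p (AddSubgroup.zmultiples P).index ≤
      padicValNat p ((W.baseChange ℚ_[p]).localTamagawaNumber ℤ_[p]))
    (hr : W.analyticRank ≤ 1) {s : ℚ} (hs : shaAn W = (s : ℂ)) (hv : padicValRat p s = 0) :
    BSDp W p := by
  obtain ⟨Dt, -, -, -⟩ := id hP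
  have hN : N = W.conductorNorm ℤ := IsNewformOf.level_eq_conductorNorm_of_exists_isNewformOf' hmod Dt.isNewformOf
  subst hN
  exact bsdp_of_carrierMultCertificate_of_swapLiterature_of_index_ne_zero_of_surj hPT hF1 h372 hGZK W K hK hD3
    hD4 hH p hp2 hmult hsurj hP hnt hfin hI hr hs hv

/-! ### §3 Carrier `p` ADDITIVE (K4) -/

/-- **`BSD(E,p)` from the bucket-B (additive) certificate on the index-finiteness line.** `p` odd, `E`
neither good nor multiplicative at `p`, the `p`-adic tower onto, `ord_p [E(K):ℤP] ≤ ord_p c_p`,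
`[E(K):ℤP] ≠ 0`, analytic rank `≤ 1`, `#Ш_an` a `p`-unit. Class-free binders: `hJ` (K4), `h44`, `hF1`,
`hrec`, `hD36`, `hGZK` — NO `hKo`, NO `hMcU`. [cite: Jetchev2008, Thm. 1.4, Cor. 1.5 (p. 812)] [cite: Miller2011LMS, Def. 1.1] -/
theorem bsdp_of_carrierAddCertificate_of_index_ne_zero
    (hJ : JetchevDivisibilityCarrierAdd)
    (h44 : McCallum1991.prop44_localOrder_kolyvaginClass_mul_eq)
    (hF1 : Gross1991_heegnerPoint_sub_ratTorsion_mem_E0)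
    (hGZK : rank_eq_analyticRank_of_analyticRank_le_one)
    (W : WeierstrassCurve ℚ) [W.IsElliptic] [W.IsGloballyMinimal] [NeZero (W.conductorNorm ℤ)]
    (K : Type) [Field K] [NumberField K]
    (hrec : heegnerPointOfConductor_one_galoisConj (W.conductorNorm ℤ) W K)
    (hD36 : phi_heegnerTau_mem_singularModuliField (W.conductorNorm ℤ) W K)
    (hK : IsImaginaryQuadratic K) (hD3 : NumberField.discr K ≠ -3) (hD4 : NumberField.discr K ≠ -4)
    (hH : SatisfiesHeegnerHypothesis (W.conductorNorm ℤ) K)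
    (p : ℕ) [Fact p.Prime] (hp2 : p ≠ 2) (hng : ¬ W.HasGoodReductionAtPrime p)
    (hnm : ¬ W.HasMultiplicativeReductionAtPrime p)
    (htower : ∀ n : ℕ, W.HasSurjectiveModNGaloisRep (p ^ n : ℕ))
    {P : (W.baseChange K).toAffine.Point} (hP : IsHeegnerPoint (W.conductorNorm ℤ) W K P)
    (hnt : ¬ IsOfFinAddOrder P) (hfin : (AddSubgroup.zmultiples P).index ≠ 0)
    (hI : padicValNat p (AddSubgroup.zmultiples P).index ≤
      padicValNat p ((W.baseChange ℚ_[p]).localTamagawaNumber ℤ_[p]))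
    (hr : W.analyticRank ≤ 1) {s : ℚ} (hs : shaAn W = (s : ℂ)) (hv : padicValRat p s = 0) :
    BSDp W p :=
  Typed.bsdp_of_shaAn_unit_of_noPTorsion W p hGZK hr hs hv
    (noPTorsion_of_globalDepth_of_index_ne_zero h44 hF1 W K hrec hD36 hK hD3 hD4 hH p hp2 htower hP hnt _
      (fun Dt β ι d₁ hy₁ s hs' n d hn hℓ ↦
        hJ W (not_hasCM_of_tower W p hp2 htower) K hK hD3 hD4 hH p hp2 hng hnm htower Dt β ι d₁ hy₁ s hs'
          n d hn hℓ) hfin hI)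

/-- **The bucket-B (additive) JET door on the index-finiteness line from NAMED PRINT ONLY** (the tower
stays a binder: mod-9 Frobenius certificate at `p = 3`, Serre at `p ≥ 5`): K4 :=
`jetchevDivisibilityCarrierAdd_of_swapLiterature`, [McC] 4.4 := `prop44_of_frobeniusCongruence`,
`hrec`/`hD36` := the Literature theorems. DISPLAYED named print: {`hPT` (∀ K), `hF1`, `h372`, `hGZK`}.
[cite: Jetchev2008, Thm. 1.4, Cor. 1.5 (p. 812)] [cite: GrossLMS1991, Prop. 3.7 (2), §10] -/
theorem bsdp_of_carrierAddCertificate_of_swapLiterature_of_index_ne_zero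
    (hPT : ∀ (K : Type) [Field K] [NumberField K], poitouTate_selmerStructure_duality_conj K)
    (hF1 : Gross1991_heegnerPoint_sub_ratTorsion_mem_E0)
    (h372 : GrossLMS1991.prop37_2_frobeniusCongruence)
    (hGZK : rank_eq_analyticRank_of_analyticRank_le_one)
    (W : WeierstrassCurve ℚ) [W.IsElliptic] [W.IsGloballyMinimal] [NeZero (W.conductorNorm ℤ)]
    (K : Type) [Field K] [NumberField K] (hK : IsImaginaryQuadratic K)
    (hD3 : NumberField.discr K ≠ -3) (hD4 : NumberField.discr K ≠ -4)
    (hH : SatisfiesHeegnerHypothesis (W.conductorNorm ℤ) K)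
    (p : ℕ) [Fact p.Prime] (hp2 : p ≠ 2) (hng : ¬ W.HasGoodReductionAtPrime p)
    (hnm : ¬ W.HasMultiplicativeReductionAtPrime p)
    (htower : ∀ n : ℕ, W.HasSurjectiveModNGaloisRep (p ^ n : ℕ))
    {P : (W.baseChange K).toAffine.Point} (hP : IsHeegnerPoint (W.conductorNorm ℤ) W K P)
    (hnt : ¬ IsOfFinAddOrder P) (hfin : (AddSubgroup.zmultiples P).index ≠ 0)
    (hI : padicValNat p (AddSubgroup.zmultiples P).index ≤
      padicValNat p ((W.baseChange ℚ_[p]).localTamagawaNumber ℤ_[p]))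
    (hr : W.analyticRank ≤ 1) {s : ℚ} (hs : shaAn W = (s : ℂ)) (hv : padicValRat p s = 0) :
    BSDp W p :=
  bsdp_of_carrierAddCertificate_of_index_ne_zero (jetchevDivisibilityCarrierAdd_of_swapLiterature hPT hF1 h372)
    (prop44_of_frobeniusCongruence h372) hF1 hGZK W K
    (heegnerPointOfConductor_one_galoisConj_holds (W.conductorNorm ℤ) W K)
    (phi_heegnerTau_mem_singularModuliField_holds (W.conductorNorm ℤ) W K) hK hD3 hD4 hH p hp2 hng hnm htower
    hP hnt hfin hI hr hs hv

/-- **Level form** (Heegner datum at a stated level `N`; Carayol from modularity `hmod`). Displayed named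
print: {PT, F1, Gross 3.7 (2), GZK, modularity}. [cite: Jetchev2008, Cor. 1.5 (p. 812)] [cite: DiamondShurman2005, Thm. 8.8.1] -/
theorem bsdp_of_carrierAddCertificate_level_of_swapLiterature_of_index_ne_zero
    (hPT : ∀ (K : Type) [Field K] [NumberField K], poitouTate_selmerStructure_duality_conj K)
    (hF1 : Gross1991_heegnerPoint_sub_ratTorsion_mem_E0)
    (h372 : GrossLMS1991.prop37_2_frobeniusCongruence)
    (hGZK : rank_eq_analyticRank_of_analyticRank_le_one) (hmod : exists_isNewformOf)
    (W : WeierstrassCurve ℚ) [W.IsElliptic] [W.IsGloballyMinimal] (p : ℕ) [Fact p.Prime]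
    {N : ℕ} [NeZero N] {K : Type} [Field K] [NumberField K] (hK : IsImaginaryQuadratic K)
    (hD3 : NumberField.discr K ≠ -3) (hD4 : NumberField.discr K ≠ -4)
    (hH : SatisfiesHeegnerHypothesis N K) {P : (W.baseChange K).toAffine.Point}
    (hP : IsHeegnerPoint N W K P) (hnt : ¬ IsOfFinAddOrder P)
    (hp2 : p ≠ 2) (hng : ¬ W.HasGoodReductionAtPrime p) (hnm : ¬ W.HasMultiplicativeReductionAtPrime p)
    (htower : ∀ n : ℕ, W.HasSurjectiveModNGaloisRep (p ^ n : ℕ))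
    (hfin : (AddSubgroup.zmultiples P).index ≠ 0)
    (hI : padicValNat p (AddSubgroup.zmultiples P).index ≤
      padicValNat p ((W.baseChange ℚ_[p]).localTamagawaNumber ℤ_[p]))
    (hr : W.analyticRank ≤ 1) {s : ℚ} (hs : shaAn W = (s : ℂ)) (hv : padicValRat p s = 0) :
    BSDp W p := by
  obtain ⟨Dt, -, -, -⟩ := id hP
  have hN : N = W.conductorNorm ℤ := IsNewformOf.level_eq_conductorNorm_of_exists_isNewformOf' hmod Dt.isNewformOf
  subst hN
  exact bsdp_of_carrierAddCertificate_of_swapLiterature_of_index_ne_zero hPT hF1 h372 hGZK W K hK hD3 hD4 hH p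
    hp2 hng hnm htower hP hnt hfin hI hr hs hv

end Summit.BirchSwinnertonDyer.Rank1Residual.JET

end
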